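import Summits.Ventures.LatticeQCDFlow.Scaling.FiniteOddsDominationCriterion

/-!
HONEST FRAMING: exact (Metropolis-corrected) sampling algorithms for lattice gauge theory; figures
of merit are autocorrelation/cost numbers at stated couplings and volumes; no continuum-physics
claim.

# AdjacentPerStepCoupling — THE OPTIMAL COUPLING OF THE TWO DELETED CONTENTS OF AN ADJACENT PAIR WHEN DOMINATION FAILS AT ONE CONTENT (THE START CONTENT, PER ATTEMPT COUNT):
# `E_πΔ' = 1 − (u_X(a) − u_Y(a)) + Σ_{c∉{a,b}}(u_Y(c) − u_X(c))⁺` EXACTLY, AND THE GROWTH MASS `E_π(Δ'−1)⁺ ≤ (u_Y(z) − u_X(z))⁺` (lean-2 GEN-43, ours)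

Venture-side (OURS).  Cell `lqcd-flow` (pub-lqcd), unit `pub-lqcd-lean-2-g43`, 2026-08-31.  Chapter AC, file 8 — a tool for the C2 ∕ C4 assembly.  For an adjacent pair
`N_X = N_C + δ_a`, `N_Y = N_C + δ_b` (`a ≠ b`) with end-hub CONTENT laws `u_X, u_Y` (push-forwards of the tagged laws, W15), chapter W file 22 showed that under domination of
every content but `b` the optimal coupling of the two deletions is monotone (`Δ' ≤ Δ = 1` on its support).  Per attempt count `j` the laws dominate each other only off the start
content `z` (Z4: `y_j(w) ≤ x_j(w)`, `w ≠ z`), and the start-content excess `(u_Y(z) − u_X(z))⁺ = (y_j(z) − x_j(z))⁺` may be paired by the optimal coupling with `X`-surplus at an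
ordinary content `c ≠ a` — a GROWTH pair, survivors at distance `2`.  Two facts, for the optimal coupling `π` of `u_X, u_Y` (LPW Prop. 4.7, tree):

* §1 **`adjacent_perStep_expect_eq`** (no domination needed): `E_πΔ' = 1 − (u_X(a) − u_Y(a)) + Σ_{w∉{a,b}}(u_Y(w) − u_X(w))⁺` — chapter V file 4's `cdist_expect_eq` with the
  diagonal `π(c,c) = u_X(c) ∧ u_Y(c)`: the net gain `D⁺ − D⁻ = 1 − E_πΔ'` is W15∕Z8's `u_X(a) − u_Y(a) − Σ_C(u_Y − u_X)⁺` for THIS coupling;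
* §2 **`adjacent_perStep_growth_le`** (domination off `{z, b}`): `E_π(Δ' − 1)⁺ ≤ (u_Y(z) − u_X(z))⁺` — off the diagonal the second deleted content has `Y`-excess, so it is `b` (no
  growth: `Y` deletes its own surplus, chapter V file 4) or `z` (growth by at most one, mass at most the column of `z` minus its diagonal).

With file 7 (`product_bracket_signed`, `r = θ ∈ [½,1]`): the `j`-attempt cycle kernel of the lumped star moves the product potential of an adjacent pair by at most
`Φ + e − R_X − R_Y − (Φ+e−2)·G_j + (y_j(z) − x_j(z))⁺`, `G_j = x_j(★) + (x_j(a) − y_j(a)) − 𝟙{z∉{a,b}}(y_j(z) − x_j(z))⁺` (memo MEMO-gen43 §3).  Literature grade (cell rule): OWN;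
the optimal coupling is LPW Prop. 4.7 (tree, cited there); nothing new cited; no new bib keys.
-/

open Finset
open Literature.Probability.MarkovChains

namespace Summit.Ventures.LatticeQCDFlow.Scaling

section PerStepCoupling
variable {S : Type*} [Fintype S] [DecidableEq S]
variable {NC NX NY : S → ℕ} {a b z : S} {utX utY : S → ℝ} {MX MY : S → S → ℕ} {Δ : (S → ℕ) → (S → ℕ) → ℕ}

/-! ## §1 The expected survivors' distance under the optimal coupling -/

/-- **`E_πΔ' = 1 − (u_X(a) − u_Y(a)) + Σ_{w∉{a,b}}(u_Y(w) − u_X(w))⁺` for the optimal coupling of an adjacent pair** (any two probability vectors `u_X, u_Y` with legal supports;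
`M^α_X, M^β_Y` the survivors). [ours] -/
theorem adjacent_perStep_expect_eq (hΔ : ∀ N N', Δ N N' = ∑ v, (N v - N' v)) (hab : a ≠ b) (hX : NX = NC + Pi.single a 1) (hY : NY = NC + Pi.single b 1)
    (hu0X : ∀ w, 0 ≤ utX w) (hu0Y : ∀ w, 0 ≤ utY w) (hu1X : ∑ w, utX w = 1) (hu1Y : ∑ w, utY w = 1)
    (hMX : ∀ α, utX α ≠ 0 → NX = MX α + Pi.single α 1) (hMY : ∀ β, utY β ≠ 0 → NY = MY β + Pi.single β 1) :
    ∑ α, ∑ β, optimalCoupling utX utY α β * (Δ (MX α) (MY β) : ℝ)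
      = 1 - (utX a - utY a) + ∑ w, (if w ≠ a ∧ w ≠ b then max (utY w - utX w) 0 else 0) := by
  classical
  have hπ := optimalCoupling_isCoupling hu0X hu0Y hu1X hu1Y
  rw [cdist_expect_eq hΔ NX NY MX MY (optimalCoupling utX utY) utX utY hπ.1 hπ.2.1 hπ.2.2 hu1X hMX hMY]
  have hD1 : (Δ NX NY : ℝ) = 1 := by exact_mod_cast adjacent_cdist_eq_one hΔ hab hX hY
  -- the three indicator sums
  have hs : ∀ w, (if NY w < NX w then (1 : ℝ) else 0) = if w = a then 1 else 0 := fun w => by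
    by_cases h : w = a
    · rw [if_pos ((adjacent_surplus_iff hX hY hab w).mpr h), if_pos h]
    · rw [if_neg (fun h' => h ((adjacent_surplus_iff hX hY hab w).mp h')), if_neg h]
  have hs' : ∀ w, (if NY w ≤ NX w then (1 : ℝ) else 0) = if w = b then 0 else 1 := fun w => by
    by_cases h : w = b
    · rw [if_pos h, if_neg (not_le.mpr ((adjacent_surplus_iff hY hX (Ne.symm hab) w).mpr h))]
    · rw [if_neg h, if_pos (not_lt.mp (fun h' => h ((adjacent_surplus_iff hY hX (Ne.symm hab) w).mp h')))]
  have hc : ∀ w, (if NX w = NY w then (1 : ℝ) else 0) = if (w ≠ a ∧ w ≠ b) then 1 else 0 := fun w => by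
    by_cases h : (w ≠ a ∧ w ≠ b)
    · rw [if_pos ((adjacent_common_iff hX hY hab w).mpr h), if_pos h]
    · rw [if_neg (fun h' => h ((adjacent_common_iff hX hY hab w).mp h')), if_neg h]
  simp_rw [hs, hs', hc, optimalCoupling_self, mul_ite, mul_one, mul_zero]
  rw [Finset.sum_ite_eq' univ a, if_pos (mem_univ a)]
  -- `Σ_{w ≠ b} u_Y(w) = 1 − u_Y(b) = u_Y(a) + Σ_{w∉{a,b}} u_Y(w)`
  have hYsplit : ∑ w, (if w = b then (0:ℝ) else utY w) = utY a + ∑ w, (if w ≠ a ∧ w ≠ b then utY w else 0) := by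
    have hpt : ∀ w, (if w = b then (0:ℝ) else utY w) = (if w = a then utY w else 0) + (if w ≠ a ∧ w ≠ b then utY w else 0) := by
      intro w
      by_cases hwa : w = a
      · subst hwa; rw [if_neg hab, if_pos rfl, if_neg (fun h => h.1 rfl)]; ring
      · by_cases hwb : w = b
        · rw [if_pos hwb, if_neg hwa, if_neg (fun h => h.2 hwb)]; ring
        · rw [if_neg hwb, if_neg hwa, if_pos ⟨hwa, hwb⟩]; ring
    rw [sum_congr rfl fun w _ => hpt w, sum_add_distrib, Finset.sum_ite_eq' univ a, if_pos (mem_univ a)]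
  rw [hYsplit]
  -- `u − u ∧ v`-terms: `u_Y(w) − min(u_X(w),u_Y(w)) = (u_Y(w) − u_X(w))⁺`
  have hmin : ∀ w, (if w ≠ a ∧ w ≠ b then utY w else 0) - (if w ≠ a ∧ w ≠ b then min (utX w) (utY w) else 0)
      = if w ≠ a ∧ w ≠ b then max (utY w - utX w) 0 else 0 := fun w => by
    split_ifs
    · rcases le_total (utX w) (utY w) with h | h
      · rw [min_eq_left h, max_eq_left (by linarith)]
      · rw [min_eq_right h, max_eq_right (by linarith)]; ring
    · ring
  have e : ∑ w, (if w ≠ a ∧ w ≠ b then max (utY w - utX w) 0 else (0:ℝ))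
      = ∑ w, (if w ≠ a ∧ w ≠ b then utY w else 0) - ∑ w, (if w ≠ a ∧ w ≠ b then min (utX w) (utY w) else 0) := by
    rw [← sum_sub_distrib]; exact sum_congr rfl fun w _ => (hmin w).symm
  rw [e, hD1]
  ring

/-! ## §2 The growth mass under domination off `{z, b}` -/

/-- **`E_π(Δ' − 1)⁺ ≤ (u_Y(z) − u_X(z))⁺` for the optimal coupling of an adjacent pair whose laws dominate each other off `{z, b}`** (`u_Y(w) ≤ u_X(w)` for `w ∉ {z, b}`; when
they dominate off `b` alone — e.g. the hub content is `b` — take `z := a`, where the bound vanishes under domination at `a`). [ours] -/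
theorem adjacent_perStep_growth_le (hΔ : ∀ N N', Δ N N' = ∑ v, (N v - N' v)) (hab : a ≠ b) (hX : NX = NC + Pi.single a 1) (hY : NY = NC + Pi.single b 1)
    (hu0X : ∀ w, 0 ≤ utX w) (hu0Y : ∀ w, 0 ≤ utY w) (hu1X : ∑ w, utX w = 1) (hu1Y : ∑ w, utY w = 1)
    (hMX : ∀ α, utX α ≠ 0 → NX = MX α + Pi.single α 1) (hMY : ∀ β, utY β ≠ 0 → NY = MY β + Pi.single β 1)
    (hdom : ∀ w, w ≠ z → w ≠ b → utY w ≤ utX w) :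
    ∑ α, ∑ β, optimalCoupling utX utY α β * max ((Δ (MX α) (MY β) : ℝ) - 1) 0 ≤ max (utY z - utX z) 0 := by
  classical
  have hπ := optimalCoupling_isCoupling hu0X hu0Y hu1X hu1Y
  have hD1 : Δ NX NY = 1 := adjacent_cdist_eq_one hΔ hab hX hY
  -- pointwise: growth only at pairs `(α, z)` with `α ≠ z`, and then by at most one
  have hpt : ∀ α β, optimalCoupling utX utY α β * max ((Δ (MX α) (MY β) : ℝ) - 1) 0
      ≤ if β = z ∧ α ≠ z then optimalCoupling utX utY α β else 0 := by
    intro α β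
    have hq0 : 0 ≤ optimalCoupling utX utY α β := hπ.1 α β
    by_cases hq : optimalCoupling utX utY α β = 0
    · rw [hq, zero_mul]; split_ifs <;> exact le_rfl
    -- legality from the marginals
    have huX : utX α ≠ 0 := by
      intro h0; apply hq
      have := (sum_eq_zero_iff_of_nonneg fun β _ => hπ.1 α β).mp (by rw [hπ.2.1 α, h0]) β (mem_univ β)
      exact this
    have huY : utY β ≠ 0 := by
      intro h0; apply hq
      have := (sum_eq_zero_iff_of_nonneg fun α _ => hπ.1 α β).mp (by rw [hπ.2.2 β, h0]) α (mem_univ α)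
      exact this
    have eX := hMX α huX
    have eY := hMY β huY
    by_cases hαβ : α = β
    · -- diagonal: the same content is deleted twice, `Δ' = Δ = 1`
      subst hαβ
      have e : Δ (MX α) (MY α) = Δ NX NY := by rw [eX, eY, cdist_add_single_same hΔ]
      rw [e, hD1]; simp
    · -- off-diagonal: `u_Y(β) > u_X(β)`, so `β ∈ {b, z}`
      have hsupp := optimalCoupling_offDiag_support hαβ hq
      by_cases hβb : β = b
      · -- `Y` deletes its own surplus content `b`: no growth
        subst hβb
        have hle : Δ (MX α) (MY β) ≤ Δ NX NY := by
          have h := cdist_survivors_le_of_mem' hΔ (MX α) (MY β) α (b := β) ?_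
          · rwa [← eX, ← eY] at h
          · -- `M^α_X(b) ≤ N_X(b) = N_C(b) = N_Y(b) − 1 = M^b_Y(b)`
            have h1 : MX α β + (if α = β then 1 else 0) = NX β := by
              have := congrArg (fun f => f β) eX; simp only [Pi.add_apply, Pi.single_apply] at this
              by_cases h : β = α
              · subst h; simp at this ⊢; omega
              · rw [if_neg h] at this; rw [if_neg (Ne.symm h)]; omega
            have h2 : MY β β + 1 = NY β := by
              have := congrArg (fun f => f β) eY; simp only [Pi.add_apply, Pi.single_apply, if_true] at this; omega
            have h3 : NX β + 1 = NY β := by rw [hX, hY]; simp [Ne.symm hab]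
            by_cases hαβ' : α = β
            · rw [if_pos hαβ'] at h1; omega
            · rw [if_neg hαβ'] at h1; omega
        rw [hD1] at hle
        have : max ((Δ (MX α) (MY β) : ℝ) - 1) 0 = 0 := by
          rw [max_eq_right]; have : (Δ (MX α) (MY β) : ℝ) ≤ 1 := by exact_mod_cast hle
          linarith
        rw [this, mul_zero]
        by_cases hc : β = z ∧ α ≠ z
        · rw [if_pos hc]; exact hq0
        · rw [if_neg hc]
      · have hβz : β = z := by
          by_contra hβz
          have := hdom β hβz hβb
          linarith [hsupp.2]
        subst hβz
        rw [if_pos ⟨rfl, hαβ⟩]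
        have hle : Δ (MX α) (MY β) ≤ Δ NX NY + 1 := by
          have h := cdist_survivors_le_add_one hΔ (MX α) (MY β) α β
          rwa [← eX, ← eY] at h
        rw [hD1] at hle
        have hm : max ((Δ (MX α) (MY β) : ℝ) - 1) 0 ≤ 1 := by
          refine max_le ?_ zero_le_one
          have : (Δ (MX α) (MY β) : ℝ) ≤ 2 := by exact_mod_cast hle
          linarith
        calc optimalCoupling utX utY α β * max ((Δ (MX α) (MY β) : ℝ) - 1) 0 ≤ optimalCoupling utX utY α β * 1 := mul_le_mul_of_nonneg_left hm hq0
          _ = optimalCoupling utX utY α β := mul_one _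
  -- sum: the column of `z` minus its diagonal entry `u_X(z) ∧ u_Y(z)`
  calc ∑ α, ∑ β, optimalCoupling utX utY α β * max ((Δ (MX α) (MY β) : ℝ) - 1) 0
      ≤ ∑ α, ∑ β, (if β = z ∧ α ≠ z then optimalCoupling utX utY α β else 0) := sum_le_sum fun α _ => sum_le_sum fun β _ => hpt α β
    _ = ∑ α, (if α ≠ z then optimalCoupling utX utY α z else 0) := by
        refine sum_congr rfl fun α _ => ?_
        by_cases hα : α ≠ z
        · rw [if_pos hα]
          rw [show (∑ β, if β = z ∧ α ≠ z then optimalCoupling utX utY α β else 0) = ∑ β, (if β = z then optimalCoupling utX utY α β else 0) from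
            sum_congr rfl fun β _ => by by_cases hβ : β = z <;> simp [hβ, hα]]
          rw [Finset.sum_ite_eq' univ z, if_pos (mem_univ z)]
        · rw [if_neg hα]; exact sum_eq_zero fun β _ => by rw [if_neg (fun h => hα h.2)]
    _ = ∑ α, optimalCoupling utX utY α z - optimalCoupling utX utY z z := by
        rw [← Finset.sum_erase_add univ (fun α => optimalCoupling utX utY α z) (mem_univ z), add_sub_cancel_right]
        rw [← Finset.sum_erase_add univ _ (mem_univ z), if_neg (fun h => h rfl), add_zero]
        exact sum_congr rfl fun α hα => by rw [if_pos (ne_of_mem_erase hα)]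
    _ = utY z - min (utX z) (utY z) := by rw [hπ.2.2 z, optimalCoupling_self]
    _ ≤ max (utY z - utX z) 0 := by
        rcases le_total (utX z) (utY z) with h | h
        · rw [min_eq_left h]; exact le_max_left _ _
        · rw [min_eq_right h, sub_self]; exact le_max_right _ _

end PerStepCoupling

end Summit.Ventures.LatticeQCDFlow.Scaling
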